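import Summits.Langlands.Langlands.Theorems.IrreducibilityBySelfDualityReciprocityUpToIrreducibilityGeometricConstituents
import Summits.Langlands.Langlands.Theorems.WeilRestrictionSplitWeilRestrictionConstituentDevissage
import Summits.Langlands.Langlands.Theorems.IrreducibilityBySelfDualityReciprocityUpToIrreducibilityDeRhamBlocks
import Literature.NumberTheory.GaloisRepresentations.FramedRepBlockSum
import HarnessLib

/-!
# An irreducible geometric constituent, with its complement, in trace form
(support item stmt-Langlands-31696 `WeilRestrictionSplit.WeilRestrictionConstituent`, helper file 2)

For a number field `K`, a prime `ℓ` and a PINNED-GEOMETRIC framed `ρ : Γ_K →ₜ* GL_n(ℚ̄_ℓ)` (`n ≥ 1`;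
unramified at almost every finite place, de Rham at every `v ∣ ℓ` for Fontaine's pinned datum
`fontainePstAdicCompletion v ℓ hv`), there are an IRREDUCIBLE pinned-geometric framed
`ϑ : Γ_K →ₜ* GL_m(ℚ̄_ℓ)`, `m ≥ 1`, and a framed `θᶜ` with `tr ρ = tr ϑ + tr θᶜ` pointwise
(`exists_irreducible_geometric_constituent_trace`).  Proof: strong induction on `n`, exactly as the
tree's `ReciprocityUpToIrreducibility.exists_geometricConstituents` (Jordan–Hölder dévissage,
Curtis–Reiner I §16B), keeping only the FIRST irreducible sub-constituent and collecting everything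
else in a block sum: if `ρ` is irreducible take `ϑ = ρ`, `θᶜ` of rank `0`; otherwise
`P ρ P⁻¹ = (A *; 0 D)` with continuous diagonal blocks of smaller positive rank, both pinned-geometric
(unramified: `isUnramifiedAt_blocks`; de Rham: Fontaine Exp. III Prop. 1.5.2 =
the tree's `stub_deRhamBlocks` / `PstWeilDeligneData.isDeRhamFramed_blocks`), recurse on `A = (ϑ, θ_A)` and put `θᶜ = θ_A ⊞ D`
(`tr (P ρ P⁻¹) = tr A + tr D`, `FramedRep.trace_blockSum`).  No definitions, no named facts.

References: C. W. Curtis, I. Reiner, *Methods of Representation Theory* I (1981), §16B;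
J.-M. Fontaine, Astérisque 223 (1994), Exp. III, Prop. 1.5.2.
-/

noncomputable section

set_option linter.dupNamespace false -- project-wide option (lakefile weak.linter.dupNamespace); `Summit.Langlands.Langlands` is the mandated namespace

open scoped NumberField MatrixGroups
open Filter IsDedekindDomain
open Literature.NumberTheory.GaloisRepresentations Literature.NumberTheory.PAdicHodge
open Summit.Langlands.Langlands.Theorems.ReciprocityUpToIrreducibility

namespace Summit.Langlands.Langlands.Theorems.WeilRestrictionConstituentProof

/-- The trace of a block upper triangular framed representation is the sum of the traces of its
diagonal blocks. [folklore] -/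
theorem trace_eq_add_of_blockTriangular {k : Type*} [Field k] [TopologicalSpace k]
    {G : Type*} [Group G] [TopologicalSpace G] {m p n : ℕ} (e : Fin m ⊕ Fin p ≃ Fin n)
    (T : FramedRep G k n) (A : FramedRep G k m) (D : FramedRep G k p)
    (hT : ∀ g, ∃ B : Matrix (Fin m) (Fin p) k,
      ((T g : GL (Fin n) k) : Matrix (Fin n) (Fin n) k) =
        Matrix.reindex e e (Matrix.fromBlocks
          ((A g : GL (Fin m) k) : Matrix (Fin m) (Fin m) k) B 0
          ((D g : GL (Fin p) k) : Matrix (Fin p) (Fin p) k)))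
    (g : G) : FramedRep.trace T g = FramedRep.trace A g + FramedRep.trace D g := by
  obtain ⟨B, hB⟩ := hT g
  simp only [FramedRep.trace]
  rw [hB, trace_reindex_fromBlocks]

/-- **An irreducible pinned-geometric constituent together with its complement, in trace form.**
Every pinned-geometric `ρ : Γ_K →ₜ* GL_n(ℚ̄_ℓ)` with `n ≥ 1` admits an irreducible pinned-geometric
framed `ϑ : Γ_K →ₜ* GL_m(ℚ̄_ℓ)`, `m ≥ 1`, and a framed `θᶜ` with `tr ρ(g) = tr ϑ(g) + tr θᶜ(g)` for
every `g ∈ Γ_K` (`ϑ` = an irreducible sub-representation in an adapted frame, `θᶜ` = the block sum of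
the remaining diagonal blocks of a Jordan–Hölder dévissage).  Strong induction on `n`
(Curtis–Reiner I §16B; de Rham heredity Fontaine Exp. III Prop. 1.5.2). [folklore] -/
theorem exists_irreducible_geometric_constituent_trace (K : Type) [Field K] [NumberField K]
    (ℓ : ℕ) [Fact ℓ.Prime] {n : ℕ} (ρ : FramedGaloisRep K (PadicAlgCl ℓ) n) (hn : 0 < n)
    (hgeo : (∀ᶠ v : HeightOneSpectrum (𝓞 K) in cofinite, ρ.IsUnramifiedAt v) ∧
      ∀ (v : HeightOneSpectrum (𝓞 K)) (hv : ((ℓ : ℕ) : 𝓞 K) ∈ v.asIdeal),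
        (fontainePstAdicCompletion v ℓ hv).IsDeRhamFramed (ρ.toLocal v)) :
    ∃ (m : ℕ) (ϑ : FramedGaloisRep K (PadicAlgCl ℓ) m) (mc : ℕ)
      (θc : FramedGaloisRep K (PadicAlgCl ℓ) mc), 0 < m ∧ ϑ.toGaloisRep.IsIrreducible ∧
      ((∀ᶠ v : HeightOneSpectrum (𝓞 K) in cofinite, ϑ.IsUnramifiedAt v) ∧
        ∀ (v : HeightOneSpectrum (𝓞 K)) (hv : ((ℓ : ℕ) : 𝓞 K) ∈ v.asIdeal),
          (fontainePstAdicCompletion v ℓ hv).IsDeRhamFramed (ϑ.toLocal v)) ∧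
      ∀ g : Field.absoluteGaloisGroup K,
        FramedRep.trace ρ g = FramedRep.trace ϑ g + FramedRep.trace θc g := by
  induction n using Nat.strong_induction_on with
  | _ n ih =>
    by_cases hirr : ρ.toGaloisRep.IsIrreducible
    · -- `ϑ = ρ`, `θᶜ` the rank-`0` representation
      let θ0 : FramedGaloisRep K (PadicAlgCl ℓ) 0 :=
        { toFun := fun _ ↦ 1
          map_one' := rfl
          map_mul' := fun _ _ ↦ (one_mul 1).symm
          continuous_toFun := continuous_const }
      refine ⟨n, ρ, 0, θ0, hn, hirr, hgeo, fun g ↦ ?_⟩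
      rw [show FramedRep.trace θ0 g = 0 from Matrix.trace_eq_zero_of_isEmpty _, add_zero]
    -- a proper non-zero stable subspace of `ℚ̄_ℓⁿ` (as in `exists_geometricConstituents`)
    have hirr' : ¬ IsSimpleOrder (Subrepresentation (FramedRep.toRepresentation ρ)) := hirr
    have hW : ∃ W : Subrepresentation (FramedRep.toRepresentation ρ), W ≠ ⊥ ∧ W ≠ ⊤ := by
      by_contra hcon
      push Not at hcon
      have hbt : (⊥ : Subrepresentation (FramedRep.toRepresentation ρ)) ≠ ⊤ := by
        intro h
        have h' := congrArg Subrepresentation.toSubmodule h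
        change (⊥ : Submodule (PadicAlgCl ℓ) (Fin n → PadicAlgCl ℓ)) = ⊤ at h'
        haveI : Nonempty (Fin n) := ⟨⟨0, hn⟩⟩
        exact bot_ne_top h'
      haveI : Nontrivial (Subrepresentation (FramedRep.toRepresentation ρ)) := ⟨⟨⊥, ⊤, hbt⟩⟩
      exact hirr' ⟨fun W ↦ or_iff_not_imp_left.mpr (hcon W)⟩
    obtain ⟨W, hW0, hW1⟩ := hW
    -- continuous dévissage with the change of frame recorded
    obtain ⟨m, p, hm0, hp0, hmn, hpn, e, P, A, D, hT⟩ :=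
      exists_conj_continuous_blocks_of_subrepresentation (k := PadicAlgCl ℓ) ρ W hW0 hW1
    have hur : ∀ v : HeightOneSpectrum (𝓞 K), ρ.IsUnramifiedAt v →
        FramedGaloisRep.IsUnramifiedAt v A ∧ FramedGaloisRep.IsUnramifiedAt v D :=
      fun v hv ↦ isUnramifiedAt_blocks e P ρ A D hT hv
    have hdR := fun v hv ↦
      isDeRhamFramed_blocks stub_deRhamBlocks e P ρ A D hT v hv (hgeo.2 v hv)
    -- recurse on the upper diagonal block
    obtain ⟨m₁, ϑ, mc₁, θ₁, hm₁, hϑirr, hϑgeo, htr₁⟩ := ih m hmn A hm0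
      ⟨hgeo.1.mono fun v hv ↦ (hur v hv).1, fun v hv ↦ (hdR v hv).1⟩
    refine ⟨m₁, ϑ, mc₁ + p, θ₁.blockSum D, hm₁, hϑirr, hϑgeo, fun g ↦ ?_⟩
    rw [← trace_conj P ρ g, trace_eq_add_of_blockTriangular e (FramedRep.conj P ρ) A D hT g,
      htr₁ g, FramedRep.trace_blockSum, add_assoc]

end Summit.Langlands.Langlands.Theorems.WeilRestrictionConstituentProof

end
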